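import Summits.PneNP.PneNP.Theorems.ChebyshevTracialDesignTightModeBudget
import Summits.PneNP.PneNP.Theorems.ChebyshevTracialDesignHSModeParseval
import Summits.PneNP.PneNP.Theorems.ChebyshevTracialDesignTightFreeSpectral
import HarnessLib

/-!
# Cell pnp-psdrank, route `ChebyshevTracialDesign`: the UNCONDITIONAL A-PRIORI BOUND for tight psd strategies of EVERY dimension —
# `TracialValueLEAt W (Σ_{κ=1}^{D/2} ρ_{2κ}√A_κ + Σ_{κ=D/2+1}^{c'} √A_κ + B·√P_D) r` for every exact design of degree `D ≤ 2c'`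

Harmonic backbone of the crux `TracialDecayExp20` (stmt-PneNP-19878), brick 45e (prover g10): the mode budget (brick 45c
`tight_virtual_modeBudget`), the Hilbert–Schmidt Parseval bound (brick 45d `HSmode_sq_le_traces`) and the truncation step (brick 35
`tracialValueLEAt_of_virtualNonneg`) compose to an unconditional bound valid for ALL tight psd strategies `(X, Y)` (`IsPsdRect`) of ALL
dimensions `r`, with NO structural input (no Keevash–Lifshitz, no Kupavskii–Zakharov):
* §1 `HSmode_abs_le` — `|C_κ| ≤ r·|PM|·N₁·√A_κ`, `A_κ = Π_{i<κ}(2i+1)/(n−2i)`, for contractions;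
* §2 `virtualSum_abs_le` — `|Σ_M Σ_{|A|≤D} tr(Q_A Y_M)·K_M(A)| ≤ |PM|·r·(Σ_{κ=1}^{D/2} (R_κ−1)·√A_κ + Σ_{κ=D/2+1}^{c'} √A_κ)` for tight psd strategies;
* §3 **`tracialValueLEAt_apriori`** — for `n` even and every exact design `(n, t = 2c'+1, T, D ≤ 2c', B, C, w)`:
  `TracialValueLEAt (levelWeight n t C w) (Σ_{κ=1}^{D/2} (R_κ−1)√A_κ + Σ_{κ=D/2+1}^{c'} √A_κ + B·√P_D) r` for every `r ≥ 1`.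
  Since `R_κ − 1 = ρ_{2κ} ≤ 2κ·y = O(κ/n)` (brick 45c `layerRatio_le_one_add`) and `√A_κ ≤ (3κ/n)^{κ/2}`, the bound is `O(n^{−3/2}) + (B+2)·√A_{D/2+1}`:
  the route text's "a-priori bound `≍ n^{−3/2}`" as a theorem, at every dimension. The crux `TracialDecayExp20` asks for `e^{−a·dq n}` in place
  of `n^{−3/2}` when `r²n < e^{a dq n}`; the whole gap sits in the LOW modes `κ ≤ D/2` (weights `ρ_{2κ}`), the deep modes being exponentially small here.
[cite: Grigoriev2001, Lemma 1.4 (PDF p. 8)] [cite: Rothvoss2017, §2 (PDF p. 6)] [cite: GriblingDelaatLaurent2019, §5] [cite: BrouwerHaemers2012, Thm. 4.9.1 (PDF p. 93)]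
Stature: support/instrument (no defs), UNCONDITIONAL. WHAT THIS IS NOT: not the crux (polynomial, not exponential, smallness); nothing on psd rank;
no P-vs-NP content. Supports stmt-PneNP-19878.
-/

set_option linter.dupNamespace false -- `Summit.PneNP.PneNP.…`: summit = sub-problem (D-0017)

noncomputable section

namespace Summit.PneNP.PneNP.Theorems.ChebyshevTracialDesignAPrioriPsd

open Finset Matrix Literature.Barriers.PneNP Literature.Computability.Complexity Literature.Combinatorics.Optimization
open Literature.Combinatorics.AssociationSchemes Literature.Combinatorics.AssociationSchemes.JohnsonHarmonics
open Literature.Combinatorics.AssociationSchemes.JohnsonSpectrum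
open Summit.PneNP.PneNP.Theorems.ChebyshevTracialDesignTightFreeSpectral (exists_tightGram_classFunction)
open Summit.PneNP.PneNP.Theorems.ChebyshevTracialDesignTightColumnSums (sum_oddSet_eq_sum_powersetCard)
open Summit.PneNP.PneNP.Theorems.ChebyshevTracialDesignAPrioriBounds (trace_le_of_sub_posSemidef)
open Summit.PneNP.PneNP.Theorems.ChebyshevTracialDesignTracialProfilePolynomial (tracialValueLEAt_of_virtualNonneg)
open Summit.PneNP.PneNP.Theorems.ChebyshevTracialDesignProfilePolynomial (card_pmatch_pos)
open Summit.PneNP.PneNP.Theorems.ChebyshevTracialDesignVirtualLayerRatio (one_le_layerRatio)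
open Summit.PneNP.PneNP.Theorems.ChebyshevTracialDesignHSModeParseval (HSmode_sq_le_traces)
open Summit.PneNP.PneNP.Theorems.ChebyshevTracialDesignTightModeBudget (tight_virtual_modeBudget)

variable {n : ℕ}

/-! ### §1 The Hilbert–Schmidt modes of contractions: `|C_κ| ≤ r·|PM|·N₁·√A_κ` -/

/-- **`|C_κ| ≤ r·|PM|·N₁·√A_κ`** for contractions `0 ⪯ X_U, Y_M ⪯ I` of any dimension `r` (`n` even, `t = 2c'+1`, `2t ≤ n`, `κ ≤ c'`, `p` the
entrywise harmonic layers of `X` on the `t`-cuts). [cite: BrouwerHaemers2012, Thm. 4.9.1 (PDF p. 93)] [cite: GriblingDelaatLaurent2019, §5] -/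
theorem HSmode_abs_le {c' κ r : ℕ} (hn : Even n) (ht : 2 * (2 * c' + 1) ≤ n) (hκ : κ ≤ c')
    (X : OddSet n → Matrix (Fin r) (Fin r) ℝ) (Y : PMatch n → Matrix (Fin r) (Fin r) ℝ)
    (hX : ∀ U, (X U).PosSemidef ∧ (1 - X U).PosSemidef) (hY : ∀ M, (Y M).PosSemidef ∧ (1 - Y M).PosSemidef)
    (p : Fin r × Fin r → ℕ → Finset (Fin n) → ℝ) (hp : ∀ ab j, IsHarmonic j (p ab j))
    (hpdec : ∀ ab (U : OddSet n), U.1.card = 2 * c' + 1 →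
      X U ab.1 ab.2 = (∑ j ∈ range (2 * c' + 1 + 1), up^[2 * c' + 1 - j] (p ab j)) U.1) :
    |∑ ab : Fin r × Fin r, ∑ M : PMatch n, Y M ab.2 ab.1 * ∑ U ∈ univ.powersetCard (2 * c' + 1),
        (up^[2 * c' + 1 - 2 * κ] (p ab (2 * κ))) U * (if (U.filter fun x => M.2.partner x ∉ U).card = 1 then (1 : ℝ) else 0)| ≤
      (r : ℝ) * ((Fintype.card (PMatch n) : ℝ) * ((((n / 2).choose (1 + c') * (1 + c').choose c' * 2 ^ 1 : ℕ) : ℝ)) *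
        Real.sqrt (∏ i ∈ range κ, ((2 * i + 1 : ℝ) / ((n : ℝ) - 2 * i)))) := by
  classical
  obtain ⟨κ₁, hA1⟩ := exists_tightGram_classFunction (n := n) (t := 2 * c' + 1) ⟨c', rfl⟩
  have h := HSmode_sq_le_traces hn ht hκ X Y hX hY p hp hpdec κ₁ hA1
  set Pm : ℝ := (Fintype.card (PMatch n) : ℝ) with hPm
  set N₁ : ℝ := ((((n / 2).choose (1 + c') * (1 + c').choose c' * 2 ^ 1 : ℕ) : ℝ)) with hN₁
  set A : ℝ := ∏ i ∈ range κ, ((2 * i + 1 : ℝ) / ((n : ℝ) - 2 * i)) with hA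
  set Cn : ℝ := (n.choose (2 * c' + 1) : ℝ) with hCn
  have hCnpos : 0 < Cn := by rw [hCn]; exact_mod_cast Nat.choose_pos (by omega)
  have hPm0 : 0 ≤ Pm := Nat.cast_nonneg _
  have hN₁0 : 0 ≤ N₁ := Nat.cast_nonneg _
  have hA0 : 0 ≤ A := prod_nonneg fun i hi => by
    have hi' := mem_range.1 hi
    have : (2 * i + 2 : ℝ) ≤ n := by exact_mod_cast (show 2 * i + 2 ≤ n by omega)
    exact div_nonneg (by positivity) (by linarith)
  -- trace masses of contractions
  have hYtr : ∑ M : PMatch n, (Y M).trace ≤ (r : ℝ) * Pm := by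
    calc ∑ M : PMatch n, (Y M).trace ≤ ∑ _M : PMatch n, (r : ℝ) := sum_le_sum fun M _ => trace_le_of_sub_posSemidef (hY M).2
      _ = (r : ℝ) * Pm := by rw [sum_const, card_univ, nsmul_eq_mul, mul_comm]
  have hXtr : ∑ U ∈ univ.filter (fun U : OddSet n => U.1.card = 2 * c' + 1), (X U).trace ≤ (r : ℝ) * Cn := by
    calc ∑ U ∈ univ.filter (fun U : OddSet n => U.1.card = 2 * c' + 1), (X U).trace
        ≤ ∑ U ∈ univ.filter (fun U : OddSet n => U.1.card = 2 * c' + 1), (fun _ : Finset (Fin n) => (r : ℝ)) U.1 :=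
          sum_le_sum fun U _ => trace_le_of_sub_posSemidef (hX U).2
      _ = (r : ℝ) * Cn := by
          have h1 := sum_oddSet_eq_sum_powersetCard (n := n) (t := 2 * c' + 1) ⟨c', rfl⟩ (fun _ => True) (fun _ => (r : ℝ))
          rw [filter_true] at h1
          have hf : univ.filter (fun U : OddSet n => U.1.card = 2 * c' + 1 ∧ True) =
              univ.filter (fun U : OddSet n => U.1.card = 2 * c' + 1) := filter_congr fun U _ => by simp
          rw [hf] at h1
          rw [h1, sum_const, card_powersetCard, card_univ, Fintype.card_fin, nsmul_eq_mul, mul_comm, hCn]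
  have hXtr0 : 0 ≤ ∑ U ∈ univ.filter (fun U : OddSet n => U.1.card = 2 * c' + 1), (X U).trace :=
    sum_nonneg fun U _ => (hX U).1.trace_nonneg
  have hsq : (∑ ab : Fin r × Fin r, ∑ M : PMatch n, Y M ab.2 ab.1 * ∑ U ∈ univ.powersetCard (2 * c' + 1),
      (up^[2 * c' + 1 - 2 * κ] (p ab (2 * κ))) U * (if (U.filter fun x => M.2.partner x ∉ U).card = 1 then (1 : ℝ) else 0)) ^ 2 ≤
        ((r : ℝ) * (Pm * N₁ * Real.sqrt A)) ^ 2 := by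
    have hfac0 : 0 ≤ Pm * N₁ ^ 2 / Cn * A := by positivity
    calc _ ≤ (∑ M : PMatch n, (Y M).trace) * (∑ U ∈ univ.filter (fun U : OddSet n => U.1.card = 2 * c' + 1), (X U).trace) *
          (Pm * N₁ ^ 2 / Cn * A) := h
      _ ≤ ((r : ℝ) * Pm) * ((r : ℝ) * Cn) * (Pm * N₁ ^ 2 / Cn * A) :=
          mul_le_mul_of_nonneg_right (mul_le_mul hYtr hXtr hXtr0 (by positivity)) hfac0
      _ = ((r : ℝ) * (Pm * N₁ * Real.sqrt A)) ^ 2 := by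
          rw [mul_pow, mul_pow, mul_pow, Real.sq_sqrt hA0]
          field_simp
  have h0 : 0 ≤ (r : ℝ) * (Pm * N₁ * Real.sqrt A) := by positivity
  exact abs_le_of_sq_le_sq' hsq h0 |> fun h' => abs_le.2 h'

/-! ### §2 The a-priori virtual bound for tight psd strategies -/

/-- **`|Σ_M Σ_{|A|≤D} tr(Q_A Y_M)·K_M(A)| ≤ |PM|·r·(Σ_{κ=1}^{D/2} (R_κ−1)√A_κ + Σ_{κ=D/2+1}^{c'} √A_κ)`** for every tight psd strategy (`IsPsdRect X Y`)
of any dimension `r`, `n` even, `t = 2c'+1`, `2t ≤ n`, `D ≤ 2c'`, `p` the entrywise layers of `X` on the `t`-cuts.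
[cite: Grigoriev2001, Lemma 1.4 (PDF p. 8)] [cite: Rothvoss2017, §2 (PDF p. 6)] [cite: GriblingDelaatLaurent2019, §5] -/
theorem virtualSum_abs_le {c' D r : ℕ} (hn : Even n) (ht : 2 * (2 * c' + 1) ≤ n) (hD : D ≤ 2 * c')
    (X : OddSet n → Matrix (Fin r) (Fin r) ℝ) (Y : PMatch n → Matrix (Fin r) (Fin r) ℝ) (hrect : IsPsdRect X Y)
    (p : Fin r × Fin r → ℕ → Finset (Fin n) → ℝ) (hp : ∀ ab j, IsHarmonic j (p ab j))
    (hpdec : ∀ ab (U : OddSet n), U.1.card = 2 * c' + 1 →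
      X U ab.1 ab.2 = (∑ j ∈ range (2 * c' + 1 + 1), up^[2 * c' + 1 - j] (p ab j)) U.1) :
    |∑ M : PMatch n, ∑ A : {A : Finset (Fin n) // A.card ≤ D},
        (Matrix.of (fun a b : Fin r =>
          (∑ j ∈ range (2 * c' + 1 + 1), ((2 * c' + 1 - j).factorial : ℝ) • (if D < j then 0 else p (a, b) j)) A.1) * Y M).trace *
          knapsackMoment M.1.card (((2 * c' + 1 : ℕ) : ℝ) / 2) (M.1.filter fun e => ∃ a ∈ A.1, a ∈ e).card| ≤
      (Fintype.card (PMatch n) : ℝ) * r *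
        (∑ κ ∈ Icc 1 (D / 2), ((∏ i ∈ range κ, (((2 * c' + 1 : ℝ) - 2 * i) * ((n : ℝ) - 2 * c' - 1 - 2 * i) /
            (((2 * c' : ℝ) - 2 * i) * ((n : ℝ) - 2 * c' - 2 - 2 * i)))) - 1) * Real.sqrt (∏ i ∈ range κ, ((2 * i + 1 : ℝ) / ((n : ℝ) - 2 * i))) +
          ∑ κ ∈ Icc (D / 2 + 1) c', Real.sqrt (∏ i ∈ range κ, ((2 * i + 1 : ℝ) / ((n : ℝ) - 2 * i)))) := by
  classical
  obtain ⟨hX, hY, htight0⟩ := hrect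
  have htight : ∀ (U : OddSet n) (M : PMatch n), U.1.card = 2 * c' + 1 → cc U M = 1 → (X U * Y M).trace = 0 :=
    fun U M _ h1 => by rw [htight0 U M h1, trace_zero]
  have hbudget := tight_virtual_modeBudget hn ht hD X Y htight p hp hpdec
  set N₁ : ℝ := ((((n / 2).choose (1 + c') * (1 + c').choose c' * 2 ^ 1 : ℕ) : ℝ)) with hN₁
  set Pm : ℝ := (Fintype.card (PMatch n) : ℝ) with hPm
  set C : ℕ → ℝ := fun κ => ∑ ab : Fin r × Fin r, ∑ M : PMatch n, Y M ab.2 ab.1 * ∑ U ∈ univ.powersetCard (2 * c' + 1),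
    (up^[2 * c' + 1 - 2 * κ] (p ab (2 * κ))) U * (if (U.filter fun x => M.2.partner x ∉ U).card = 1 then (1 : ℝ) else 0) with hC
  set R : ℕ → ℝ := fun κ => ∏ i ∈ range κ, (((2 * c' + 1 : ℝ) - 2 * i) * ((n : ℝ) - 2 * c' - 1 - 2 * i) /
    (((2 * c' : ℝ) - 2 * i) * ((n : ℝ) - 2 * c' - 2 - 2 * i))) with hR
  set sA : ℕ → ℝ := fun κ => Real.sqrt (∏ i ∈ range κ, ((2 * i + 1 : ℝ) / ((n : ℝ) - 2 * i))) with hsA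
  set V : ℝ := ∑ M : PMatch n, ∑ A : {A : Finset (Fin n) // A.card ≤ D},
        (Matrix.of (fun a b : Fin r =>
          (∑ j ∈ range (2 * c' + 1 + 1), ((2 * c' + 1 - j).factorial : ℝ) • (if D < j then 0 else p (a, b) j)) A.1) * Y M).trace *
          knapsackMoment M.1.card (((2 * c' + 1 : ℕ) : ℝ) / 2) (M.1.filter fun e => ∃ a ∈ A.1, a ∈ e).card with hV
  change V * N₁ = ∑ κ ∈ Icc 1 (D / 2), (R κ - 1) * C κ - ∑ κ ∈ Icc (D / 2 + 1) c', C κ at hbudget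
  change |V| ≤ Pm * r * (∑ κ ∈ Icc 1 (D / 2), (R κ - 1) * sA κ + ∑ κ ∈ Icc (D / 2 + 1) c', sA κ)
  have hN₁pos : 0 < N₁ := by
    rw [hN₁]
    have h1 : 0 < (n / 2).choose (1 + c') := Nat.choose_pos (by omega)
    have h2 : 0 < (1 + c').choose c' := Nat.choose_pos (by omega)
    exact_mod_cast Nat.mul_pos (Nat.mul_pos h1 h2) (by norm_num)
  -- the mode bounds
  have hCle : ∀ κ, κ ≤ c' → |C κ| ≤ (r : ℝ) * (Pm * N₁ * sA κ) := fun κ hκ => HSmode_abs_le hn ht hκ X Y hX hY p hp hpdec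
  have hR1 : ∀ κ ∈ Icc 1 (D / 2), 0 ≤ R κ - 1 := fun κ hκ =>
    sub_nonneg.2 (one_le_layerRatio (a := c') ht (by have := (mem_Icc.1 hκ).2; omega))
  -- `|V|·N₁ ≤ Σ (R−1)|C| + Σ |C| ≤ r·Pm·N₁·(Σ (R−1) sA + Σ sA)`
  have h1 : |V| * N₁ ≤ ∑ κ ∈ Icc 1 (D / 2), (R κ - 1) * |C κ| + ∑ κ ∈ Icc (D / 2 + 1) c', |C κ| := by
    rw [← abs_of_pos hN₁pos, ← abs_mul, hbudget]
    refine (abs_sub _ _).trans (add_le_add ((abs_sum_le_sum_abs _ _).trans (sum_le_sum fun κ hκ => ?_)) (abs_sum_le_sum_abs _ _))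
    rw [abs_mul, abs_of_nonneg (hR1 κ hκ)]
  have h2 : ∑ κ ∈ Icc 1 (D / 2), (R κ - 1) * |C κ| + ∑ κ ∈ Icc (D / 2 + 1) c', |C κ| ≤
      ∑ κ ∈ Icc 1 (D / 2), (R κ - 1) * ((r : ℝ) * (Pm * N₁ * sA κ)) + ∑ κ ∈ Icc (D / 2 + 1) c', (r : ℝ) * (Pm * N₁ * sA κ) :=
    add_le_add (sum_le_sum fun κ hκ => mul_le_mul_of_nonneg_left (hCle κ (by have := (mem_Icc.1 hκ).2; omega)) (hR1 κ hκ))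
      (sum_le_sum fun κ hκ => hCle κ (mem_Icc.1 hκ).2)
  have h3 : ∑ κ ∈ Icc 1 (D / 2), (R κ - 1) * ((r : ℝ) * (Pm * N₁ * sA κ)) + ∑ κ ∈ Icc (D / 2 + 1) c', (r : ℝ) * (Pm * N₁ * sA κ) =
      (Pm * r * (∑ κ ∈ Icc 1 (D / 2), (R κ - 1) * sA κ + ∑ κ ∈ Icc (D / 2 + 1) c', sA κ)) * N₁ := by
    rw [mul_add, add_mul, mul_sum, mul_sum, sum_mul, sum_mul]
    congr 1 <;> exact sum_congr rfl fun κ _ => by ring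
  have h4 := (h1.trans h2).trans_eq h3
  exact le_of_mul_le_mul_right h4 hN₁pos

/-! ### §3 The a-priori tracial value bound at every dimension -/

/-- **THE A-PRIORI BOUND (unconditional, every dimension).** For `n` even, every exact design `(n, t = 2c'+1, T, D, B, C, w)` with `D ≤ 2c'`,
and every `r ≥ 1`:
`TracialValueLEAt (levelWeight n t C w) (Σ_{κ=1}^{D/2} (R_κ−1)·√A_κ + Σ_{κ=D/2+1}^{c'} √A_κ + B·√P_D) r`,
`R_κ = Π_{i<κ}(t−2i)(n−t−2i)/((t−1−2i)(n−t−1−2i))`, `A_κ = Π_{i<κ}(2i+1)/(n−2i)`, `P_D = A_{D/2+1}`.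
[cite: Grigoriev2001, Lemma 1.4 (PDF p. 8)] [cite: Rothvoss2017, §2 (PDF p. 6)] [cite: GriblingDelaatLaurent2019, §5] -/
theorem tracialValueLEAt_apriori {c' T D r : ℕ} {Bv : ℝ} {C : Finset ℕ} {w : ℕ → ℝ} (hn : Even n)
    (hdes : IsExactDesign n (2 * c' + 1) T D Bv C w) (hD : D ≤ 2 * c') (hr : 0 < r) :
    TracialValueLEAt (levelWeight n (2 * c' + 1) C w)
      ((∑ κ ∈ Icc 1 (D / 2), ((∏ i ∈ range κ, (((2 * c' + 1 : ℝ) - 2 * i) * ((n : ℝ) - 2 * c' - 1 - 2 * i) /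
            (((2 * c' : ℝ) - 2 * i) * ((n : ℝ) - 2 * c' - 2 - 2 * i)))) - 1) * Real.sqrt (∏ i ∈ range κ, ((2 * i + 1 : ℝ) / ((n : ℝ) - 2 * i))) +
          ∑ κ ∈ Icc (D / 2 + 1) c', Real.sqrt (∏ i ∈ range κ, ((2 * i + 1 : ℝ) / ((n : ℝ) - 2 * i)))) +
        Bv * Real.sqrt (∏ i ∈ range (D / 2 + 1), ((2 * i + 1 : ℝ) / ((n : ℝ) - 2 * i)))) r := by
  have ht : 2 * (2 * c' + 1) ≤ n := by have := hdes.2.1; omega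
  refine tracialValueLEAt_of_virtualNonneg hn hdes hD hr fun X Y hrect p hp hpdec => ?_
  have hPm : (0 : ℝ) < Fintype.card (PMatch n) := by exact_mod_cast card_pmatch_pos hn
  have h := (abs_le.1 (virtualSum_abs_le hn ht hD X Y hrect p hp hpdec)).1
  calc _ = (Fintype.card (PMatch n) : ℝ)⁻¹ * -((Fintype.card (PMatch n) : ℝ) * r *
        (∑ κ ∈ Icc 1 (D / 2), ((∏ i ∈ range κ, (((2 * c' + 1 : ℝ) - 2 * i) * ((n : ℝ) - 2 * c' - 1 - 2 * i) /
            (((2 * c' : ℝ) - 2 * i) * ((n : ℝ) - 2 * c' - 2 - 2 * i)))) - 1) * Real.sqrt (∏ i ∈ range κ, ((2 * i + 1 : ℝ) / ((n : ℝ) - 2 * i))) +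
          ∑ κ ∈ Icc (D / 2 + 1) c', Real.sqrt (∏ i ∈ range κ, ((2 * i + 1 : ℝ) / ((n : ℝ) - 2 * i))))) := by
        field_simp
    _ ≤ _ := mul_le_mul_of_nonneg_left h (inv_nonneg.2 hPm.le)

end Summit.PneNP.PneNP.Theorems.ChebyshevTracialDesignAPrioriPsd
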